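import Summits.BirchSwinnertonDyer.Rank1Residual.Additive.GordRankZeroUpperHalfOfProp414
import HarnessLib

/-!
# X4(M), rank `0`, `surj(p)`, `B = 0` rows: the UPPER half and `BSD(E,p)` with Delbourgo 1998 Prop. 4
# REPLACED by Greenberg's Prop. 4.14 record + control — the (M) twin of T-CTL-UP FILE 3b
# (team n1011, row T-CTL-UP, seat p06 GEN 11, FILE 4 — r2 GEN 40's ask: 'the 34 (M) rows @ 3 only
# behind an (M) consumer of F2')

HONEST FRAMING (cell `b2b-bsdres-*`, team n1011, verbatim): prove what is provable now; shrink each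
hard class to its core with data; no claim beyond stated classes. Research route on
CONSTRUCTION-SHAPED X4 / §I N10–N11; ASSEMBLY theorems only — no definition, no named fact, nothing
booked, no residual-map mark moved, no class closed. X4(M) stays CONSTRUCTION-SHAPED (the typed
`χ_p`-branch inputs / the LOWER half stay OPEN exactly as in additive-p4's ENDs); what changes is ONE
named fact in the binder list. NOTHING of additive-p4's (`AdditivePotMult/RankZeroChiBranch{,Three,PrimeFacts}`)
is edited: the theorems below are twins with `hDel ↦ (h414, S, hgood, hB)`.

## What

additive-p4's `ClassX4M.missingUpperBoundAt_rankZero_of_surj` (`RankZeroChiBranchPrimeFacts`) gives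
`ord_p #Ш(E) ≤ ord_p #Ш_an(E)` on X4(M) ∧ `r_an = 0` ∧ `surj(p)`, every odd `p`, from {**Delbourgo
1998 Prop. 4 (`hDel`)**, GZK, modularity (`hmod`, `hmodD`), Wuthrich 2014 Lemma 20 (`hL20`, `p = 3`
road), Kato's half-eigenspace reading (`hKato`)}. Here: the same with `hDel` REPLACED by {**Greenberg's
Prop. 4.14 record `h414`**, the census place data `S / hgood`, **`hB : p ∤ Tam(E)`**, and Tate's
uniformisation `hT41` (A41 — already in the (M) rows' lower half, T-T3M) for the socket above `p`
(`AdditivePotMult.ClassX4M.localTowerKerPrimary_zero_eq_bot`, `= ⊥` for every `ℤ_p`-extension)}: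

* `ClassX4M.missingUpperBoundAt_three_rankZero_of_chiBranch_of_surj_of_prop414` (`p = 3`, Wuthrich
  Lemma 20 road), `ClassX4M.missingUpperBoundAt_rankZero_of_chiBranch_of_prop414` (`p ≠ 3` or `ram`),
  `…_of_chiBranch_of_surj_of_odd_of_prop414` (every odd `p`);
* **`ClassX4M.missingUpperBoundAt_rankZero_of_surj_of_prop414 (h414 hT41 hGZK hmod hmodD hL20 hKato)
  (hX hr hsurj S hgood hB)`** — binder diff against additive-p4's END: REMOVED {`hDel`}, ADDED
  {`h414`, `hT41`, `S`, `hgood`, `hB`}; `…_of_shaAn_unit`, `…missingInputAt_iff_lower…`,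
  `…_of_lower_of_prop414`;
* CAPSTONE **`ClassX4M.bsdp_rankZero_of_facts_of_cycLowerBound_tamagawaSharp_of_prop414`** —
  X4(M) ∧ `r_an = 0` ∧ `surj(p)` ∧ `p ∤ Tam(E)`, every odd `p`: `BSD(E,p)` from the typed
  `CycLowerBoundAt` + {A41, Prop. 4.14, GZK, modularity, Wuthrich L20, Kato half-eigenspace} — NO
  Delbourgo 1998 / 2002 (T-CTL-TAM♯'s lower half `ClassX4M.missingLowerBoundAt_rankZero_of_cycLowerBound_tamagawaSharp`
  + this file's upper half).

Scope: Prop. 4.14's printed proof covers potentially multiplicative reduction at `p` (record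
docstring). NOT claimed: `B ≥ 1` rows; X3♯(M) twins (reducible rows carry `htors` and Wuthrich
Thm. 16 instead of Kato — same mechanics, on a consumer's word). Axioms standard.

References: [GreenbergLNM1716] Prop. 4.14, §4 Thm. 4.1; [Wuthrich2014] Lemma 20, Thm. 3, Cor. 19;
[Kato2004Asterisque] Thm. 17.4 (3); [SilvermanATAEC1994] Thm. V.5.3 (A41); [Delbourgo1998] Prop. 4
(REPLACED); [Miller2011LMS] Def. 1.1; cells/n1011/skel/T-CTL-UP.md.
-/

noncomputable section

open scoped Classical MatrixGroups ModularForm NumberField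

open CongruenceSubgroup WeierstrassCurve NumberField Literature.NumberTheory.EllipticCurves
  Literature.NumberTheory.EllipticCurves.ModularForms
  Literature.NumberTheory.EllipticCurves.Rank1Residual
  Literature.NumberTheory.EllipticCurves.Rank1Residual.Typed
  IsDedekindDomain Rat.HeightOneSpectrum
  Summit.BirchSwinnertonDyer.Rank1Residual.Iwasawa

namespace Summit.BirchSwinnertonDyer.Rank1Residual.AdditivePotMult

open Additive

variable {W : WeierstrassCurve ℚ} [W.IsElliptic] [W.IsGloballyMinimal]

/-! ### §1 `p = 3`: the Wuthrich-Lemma-20 road -/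

/-- **X4(M) ∧ `p = 3` ∧ `r_an = 0` ∧ `surj(3)` ∧ `3 ∤ Tam(E)`: `Typed.MissingUpperBoundAt W 3` from the
typed odd-branch input, with Delbourgo 1998 Prop. 4 REPLACED by Greenberg's Prop. 4.14 record** — the
`3`-adic image of the multiplicative twist by Wuthrich Lemma 20 (`hL20`), `c_3(E)` a `3`-unit on these
rows, the socket above `3` by T-T3M (`hT41`), `3 ∤ #E(ℚ)_tors` by `Irr`; binders vs additive-p4's
`ClassX4M.missingUpperBoundAt_three_rankZero_of_chiBranch_of_surj`: REMOVED `hDel`, ADDED `h414`,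
`hT41`, `S`, `hgood`, `hB`. [cite: Wuthrich2014, Lemma 20 (p. 399)] [cite: GreenbergLNM1716, Prop. 4.14] -/
theorem ClassX4M.missingUpperBoundAt_three_rankZero_of_chiBranch_of_surj_of_prop414
    (h414 : Greenberg1999.prop414_noFiniteSubmodule_of_not_dvd_torsionOrder)
    (hT41 : Silverman1994_thmV53_corV54_tateUniformisation.{0})
    (hGZK : rank_eq_analyticRank_of_analyticRank_le_one) (hmod : hasEntireLFunction_rat)
    (hmodD : nonempty_modularParametrizationData)
    (hL20 : Wuthrich2014.lemma20_surjective_threeAdic_of_semistable)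
    (hBCodd : ChiBranchLeadingTermOddBigImageAt W 3)
    (hX : ClassX4M W 3) (hr : W.analyticRank = 0) (hsurj : Surj W 3)
    (S : Finset (HeightOneSpectrum (𝓞 ℚ)))
    (hgood : ∀ v ∉ S, ((3 : ℕ) : 𝓞 ℚ) ∉ v.asIdeal ∧ W.HasGoodReductionAt v)
    (hB : ¬ 3 ∣ W.tamagawaProduct) : MissingUpperBoundAt W 3 := by
  obtain ⟨V, iV, iVm, C, hV, hC⟩ := hX.exists_mult_pStar_twist_model
  have hC' : C • V.quadraticTwist (-3 : ℚ) = W := by norm_num at hC; exact hC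
  haveI : NeZero (V.conductorNorm ℤ) := ⟨(V.conductorNorm_pos_holds).ne'⟩
  obtain ⟨Dm⟩ := hmodD V
  obtain ⟨ϖ', -, hϖ'⟩ := exists_rat_mul_imaginaryPeriodRat_eq_minusPeriod Dm
  obtain ⟨q, hq, hle⟩ := X4RankZeroTwistOdd.padicValNat_shaOrder_le_shaAn_of_prop414 W 3 h414 hGZK
    hmod hBCodd (by norm_num) hr hX.1 S
    (fun κ _ v _ hpv ↦ by
      rw [AdditivePotMult.ClassX4M.localTowerKerPrimary_zero_eq_bot hT41 hX hpv κ]; infer_instance)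
    hgood hB V C (by push_cast; exact hC') (Or.inr hV)
    (hX.forall_surj_pow_three_twist_of_surj hL20 hsurj V C hC') Dm.isNewformOf ϖ' hϖ'
  exact ⟨q, hq, hle⟩

/-! ### §2 `p ≠ 3` (or `ram`): the V9b glue road -/

/-- **X4(M) ∧ `r_an = 0` ∧ big image (`ram(3)` if `p = 3`) ∧ `p ∤ Tam(E)`: `Typed.MissingUpperBoundAt W p`
from the typed `χ_p`-branch inputs, with Delbourgo 1998 Prop. 4 REPLACED by Greenberg's Prop. 4.14
record** — twin of additive-p4's `ClassX4M.missingUpperBoundAt_rankZero_of_chiBranch` (`V` = minimal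
model of `E^{(p*)}`, multiplicative at `p`; newform / period ratios from `hmodD`); socket above `p`
by T-T3M (`hT41`). [cite: GreenbergLNM1716, Prop. 4.14] [cite: EdixhovenManin1991, §1] -/
theorem ClassX4M.missingUpperBoundAt_rankZero_of_chiBranch_of_prop414 {p : ℕ} [hp : Fact p.Prime]
    (h414 : Greenberg1999.prop414_noFiniteSubmodule_of_not_dvd_torsionOrder)
    (hT41 : Silverman1994_thmV53_corV54_tateUniformisation.{0})
    (hGZK : rank_eq_analyticRank_of_analyticRank_le_one) (hmod : hasEntireLFunction_rat)
    (hmodD : nonempty_modularParametrizationData)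
    (hBCeven : ChiBranchLeadingTermBigImageAt W p) (hBCodd : ChiBranchLeadingTermOddBigImageAt W p)
    (hX : ClassX4M W p) (hr : W.analyticRank = 0) (hsurj : Surj W p) (hram3 : p = 3 → Ram W p)
    (S : Finset (HeightOneSpectrum (𝓞 ℚ)))
    (hgood : ∀ v ∉ S, (p : 𝓞 ℚ) ∉ v.asIdeal ∧ W.HasGoodReductionAt v) (hB : ¬ p ∣ W.tamagawaProduct) :
    MissingUpperBoundAt W p := by
  obtain ⟨V, iV, iVm, C, hV, hC⟩ := hX.exists_mult_pStar_twist_model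
  haveI : NeZero (V.conductorNorm ℤ) := ⟨(V.conductorNorm_pos_holds).ne'⟩
  obtain ⟨Dm⟩ := hmodD V
  obtain ⟨ϖ, -, hϖ, -⟩ := Dm.exists_rat_mul_realPeriodRat_eq_plusPeriod
  obtain ⟨ϖ', -, hϖ'⟩ := exists_rat_mul_imaginaryPeriodRat_eq_minusPeriod Dm
  exact X4RankZeroTwist.missingUpperBoundAt_of_odd_prime_of_surj_of_prop414 W p h414 hGZK hmod hBCeven
    hBCodd hX.p_ne_two hr hX.1 hsurj hram3 S
    (fun κ _ v _ hpv ↦ by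
      rw [AdditivePotMult.ClassX4M.localTowerKerPrimary_zero_eq_bot hT41 hX hpv κ]; infer_instance)
    hgood hB V C hC (Or.inr hV) Dm.isNewformOf ϖ hϖ ϖ' hϖ'

/-- **X4(M) ∧ `r_an = 0` ∧ `surj(p)` ∧ `p ∤ Tam(E)`, ANY odd `p` (`p = 3` included, NO `ram` binder):
`Typed.MissingUpperBoundAt W p` from the typed `χ_p`-branch inputs with Delbourgo 1998 Prop. 4
REPLACED by Greenberg's Prop. 4.14 record** (at `p = 3` §1, else §2 with a vacuous `ram` premise).
[cite: GreenbergLNM1716, Prop. 4.14] [cite: Wuthrich2014, Lemma 20 (p. 399)] -/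
theorem ClassX4M.missingUpperBoundAt_rankZero_of_chiBranch_of_surj_of_odd_of_prop414 {p : ℕ}
    [hp : Fact p.Prime]
    (h414 : Greenberg1999.prop414_noFiniteSubmodule_of_not_dvd_torsionOrder)
    (hT41 : Silverman1994_thmV53_corV54_tateUniformisation.{0})
    (hGZK : rank_eq_analyticRank_of_analyticRank_le_one) (hmod : hasEntireLFunction_rat)
    (hmodD : nonempty_modularParametrizationData)
    (hL20 : Wuthrich2014.lemma20_surjective_threeAdic_of_semistable)
    (hBCeven : ChiBranchLeadingTermBigImageAt W p) (hBCodd : ChiBranchLeadingTermOddBigImageAt W p)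
    (hX : ClassX4M W p) (hr : W.analyticRank = 0) (hsurj : Surj W p)
    (S : Finset (HeightOneSpectrum (𝓞 ℚ)))
    (hgood : ∀ v ∉ S, (p : 𝓞 ℚ) ∉ v.asIdeal ∧ W.HasGoodReductionAt v) (hB : ¬ p ∣ W.tamagawaProduct) :
    MissingUpperBoundAt W p := by
  by_cases hp3 : p = 3
  · subst hp3
    exact ClassX4M.missingUpperBoundAt_three_rankZero_of_chiBranch_of_surj_of_prop414 h414 hT41 hGZK
      hmod hmodD hL20 hBCodd hX hr hsurj S hgood hB
  · exact ClassX4M.missingUpperBoundAt_rankZero_of_chiBranch_of_prop414 h414 hT41 hGZK hmod hmodD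
      hBCeven hBCodd hX hr hsurj (fun h ↦ absurd h hp3) S hgood hB

/-! ### §3 The branch inputs discharged: the (M) class ENDs with `hDel` replaced -/

variable {p : ℕ} [hp : Fact p.Prime]

/-- **X4(M) ∧ `r_an(E) = 0` ∧ `surj(p)` ∧ `p ∤ Tam(E)`, ANY odd `p`: the upper half
`ord_p #Ш(E) ≤ ord_p #Ш_an(E)` from published theorems + kernel glue, with Delbourgo 1998 Prop. 4
REPLACED by Greenberg's Prop. 4.14 record** — fact list {Prop. 4.14 (`h414`), A41 Tate
uniformisation (`hT41`, socket above `p`), GZK, modularity (`hmod`, `hmodD`), Wuthrich 2014 Lemma 20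
(`hL20`), Kato's half-eigenspace reading (`hKato`)}; the branch inputs DISCHARGED by
`PotMult.chiBranchLeadingTerm[Odd]BigImageAt_of_halfFact`. Binder diff against additive-p4's
`ClassX4M.missingUpperBoundAt_rankZero_of_surj`: REMOVED {`hDel`}, ADDED {`h414`, `hT41`, `S`, `hgood`,
`hB`}. X4(M) stays CONSTRUCTION-SHAPED; nothing booked.
[cite: GreenbergLNM1716, Prop. 4.14] [cite: Wuthrich2014, Lemma 20 (p. 399), Thm. 3 (p. 383), Cor. 19 (p. 398)]
[cite: Kato2004Asterisque, Thm. 17.4 (3) (p. 273)] -/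
theorem ClassX4M.missingUpperBoundAt_rankZero_of_surj_of_prop414
    (h414 : Greenberg1999.prop414_noFiniteSubmodule_of_not_dvd_torsionOrder)
    (hT41 : Silverman1994_thmV53_corV54_tateUniformisation.{0})
    (hGZK : rank_eq_analyticRank_of_analyticRank_le_one) (hmod : hasEntireLFunction_rat)
    (hmodD : nonempty_modularParametrizationData)
    (hL20 : Wuthrich2014.lemma20_surjective_threeAdic_of_semistable)
    (hKato : Wuthrich2014.kato_halfEigenCharIdeal_dvd_cyclotomicPrime_of_surjective)
    (hX : ClassX4M W p) (hr : W.analyticRank = 0) (hsurj : Surj W p)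
    (S : Finset (HeightOneSpectrum (𝓞 ℚ)))
    (hgood : ∀ v ∉ S, (p : 𝓞 ℚ) ∉ v.asIdeal ∧ W.HasGoodReductionAt v) (hB : ¬ p ∣ W.tamagawaProduct) :
    MissingUpperBoundAt W p :=
  ClassX4M.missingUpperBoundAt_rankZero_of_chiBranch_of_surj_of_odd_of_prop414 h414 hT41 hGZK hmod hmodD
    hL20 ((ClassX4M.potMult W p hX).chiBranchLeadingTermBigImageAt_of_halfFact hKato)
    ((ClassX4M.potMult W p hX).chiBranchLeadingTermOddBigImageAt_of_halfFact hKato) hX hr hsurj S hgood hB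

/-- **… and `BSD(E,p)` on the `p ∤ #Ш_an(E)` rows** (Delbourgo-free fact list).
[cite: GreenbergLNM1716, Prop. 4.14] [cite: Wuthrich2014, Lemma 20 (p. 399), Cor. 19 (p. 398)] -/
theorem ClassX4M.bsdp_rankZero_of_surj_of_prop414_of_shaAn_unit
    (h414 : Greenberg1999.prop414_noFiniteSubmodule_of_not_dvd_torsionOrder)
    (hT41 : Silverman1994_thmV53_corV54_tateUniformisation.{0})
    (hGZK : rank_eq_analyticRank_of_analyticRank_le_one) (hmod : hasEntireLFunction_rat)
    (hmodD : nonempty_modularParametrizationData)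
    (hL20 : Wuthrich2014.lemma20_surjective_threeAdic_of_semistable)
    (hKato : Wuthrich2014.kato_halfEigenCharIdeal_dvd_cyclotomicPrime_of_surjective)
    (hX : ClassX4M W p) (hr : W.analyticRank = 0) (hsurj : Surj W p)
    (S : Finset (HeightOneSpectrum (𝓞 ℚ)))
    (hgood : ∀ v ∉ S, (p : 𝓞 ℚ) ∉ v.asIdeal ∧ W.HasGoodReductionAt v) (hB : ¬ p ∣ W.tamagawaProduct)
    {q : ℚ} (hq : shaAn W = (q : ℂ)) (hv : padicValRat p q = 0) : BSDp W p :=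
  bsdp_of_missingPPartAt W p hGZK (by rw [hr]; exact zero_le_one)
    (missingPPartAt_of_upper_of_shaAn_unit W p
      (ClassX4M.missingUpperBoundAt_rankZero_of_surj_of_prop414 h414 hT41 hGZK hmod hmodD hL20 hKato hX
        hr hsurj S hgood hB) hq hv)

/-- **… what remains is EXACTLY the lower half**: `X4.MissingInputAt W p ↔ MissingLowerBoundAt W p`
(Delbourgo-free fact list). [cite: GreenbergLNM1716, Prop. 4.14] [cite: Wuthrich2014, Lemma 20 (p. 399)] -/
theorem ClassX4M.missingInputAt_iff_lower_rankZero_of_surj_of_prop414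
    (h414 : Greenberg1999.prop414_noFiniteSubmodule_of_not_dvd_torsionOrder)
    (hT41 : Silverman1994_thmV53_corV54_tateUniformisation.{0})
    (hGZK : rank_eq_analyticRank_of_analyticRank_le_one) (hmod : hasEntireLFunction_rat)
    (hmodD : nonempty_modularParametrizationData)
    (hL20 : Wuthrich2014.lemma20_surjective_threeAdic_of_semistable)
    (hKato : Wuthrich2014.kato_halfEigenCharIdeal_dvd_cyclotomicPrime_of_surjective)
    (hX : ClassX4M W p) (hr : W.analyticRank = 0) (hsurj : Surj W p)
    (S : Finset (HeightOneSpectrum (𝓞 ℚ)))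
    (hgood : ∀ v ∉ S, (p : 𝓞 ℚ) ∉ v.asIdeal ∧ W.HasGoodReductionAt v) (hB : ¬ p ∣ W.tamagawaProduct) :
    X4.MissingInputAt W p ↔ MissingLowerBoundAt W p :=
  ⟨fun h ↦ (lower_and_upper_of_missingPPartAt W p h).1, fun h ↦
    missingPPartAt_of_lower_of_upper W p h
      (ClassX4M.missingUpperBoundAt_rankZero_of_surj_of_prop414 h414 hT41 hGZK hmod hmodD hL20 hKato hX
        hr hsurj S hgood hB)⟩

/-- **… and `BSD(E,p)` from the LOWER half over `ℚ`** (Delbourgo-free fact list).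
[cite: GreenbergLNM1716, Prop. 4.14] [cite: Wuthrich2014, Lemma 20 (p. 399)] -/
theorem ClassX4M.bsdp_rankZero_of_surj_of_lower_of_prop414
    (h414 : Greenberg1999.prop414_noFiniteSubmodule_of_not_dvd_torsionOrder)
    (hT41 : Silverman1994_thmV53_corV54_tateUniformisation.{0})
    (hGZK : rank_eq_analyticRank_of_analyticRank_le_one) (hmod : hasEntireLFunction_rat)
    (hmodD : nonempty_modularParametrizationData)
    (hL20 : Wuthrich2014.lemma20_surjective_threeAdic_of_semistable)
    (hKato : Wuthrich2014.kato_halfEigenCharIdeal_dvd_cyclotomicPrime_of_surjective)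
    (hX : ClassX4M W p) (hr : W.analyticRank = 0) (hsurj : Surj W p)
    (S : Finset (HeightOneSpectrum (𝓞 ℚ)))
    (hgood : ∀ v ∉ S, (p : 𝓞 ℚ) ∉ v.asIdeal ∧ W.HasGoodReductionAt v) (hB : ¬ p ∣ W.tamagawaProduct)
    (hlow : MissingLowerBoundAt W p) : BSDp W p :=
  bsdp_of_missingPPartAt W p hGZK (by rw [hr]; exact zero_le_one)
    (missingPPartAt_of_lower_of_upper W p hlow
      (ClassX4M.missingUpperBoundAt_rankZero_of_surj_of_prop414 h414 hT41 hGZK hmod hmodD hL20 hKato hX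
        hr hsurj S hgood hB))

/-- **CAPSTONE — X4(M) ∧ `r_an(E) = 0` ∧ `surj(p)` ∧ `p ∤ Tam(E)`, every odd `p` (`p = 3` included):
`BSD(E,p)` from the typed LOWER input `CycLowerBoundAt W p Dh` and the named facts {A41, Greenberg
Prop. 4.14, GZK, modularity, Wuthrich 2014 Lemma 20, Kato half-eigenspace} — NO Delbourgo 1998 / 2002
anywhere**: lower half = T-CTL-TAM♯'s `ClassX4M.missingLowerBoundAt_rankZero_of_cycLowerBound_tamagawaSharp`
(control, A41 socket, Tamagawa numbers free), upper half this file. Twin of GEN 10's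
`ClassX4M.bsdp_rankZero_of_facts_of_cycLowerBound_tamagawaSharp` with `hDel98 ↦ (h414, hB)`. X4(M) stays
CONSTRUCTION-SHAPED (typed input OPEN); nothing booked.
[cite: GreenbergLNM1716, §3 Lemma 3.3, §4 Thm. 4.1 and Prop. 4.14] [cite: Wuthrich2014, Lemma 20 (p. 399), Cor. 19 (p. 398)]
[cite: Miller2011LMS, Def. 1.1] -/
theorem ClassX4M.bsdp_rankZero_of_facts_of_cycLowerBound_tamagawaSharp_of_prop414
    (hT41 : Silverman1994_thmV53_corV54_tateUniformisation.{0})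
    (h414 : Greenberg1999.prop414_noFiniteSubmodule_of_not_dvd_torsionOrder)
    (hGZK : rank_eq_analyticRank_of_analyticRank_le_one) (hmod : hasEntireLFunction_rat)
    (hmodD : nonempty_modularParametrizationData)
    (hL20 : Wuthrich2014.lemma20_surjective_threeAdic_of_semistable)
    (hKato : Wuthrich2014.kato_halfEigenCharIdeal_dvd_cyclotomicPrime_of_surjective)
    (hX : ClassX4M W p) (hr : W.analyticRank = 0) (hsurj : Surj W p)
    (S : Finset (HeightOneSpectrum (𝓞 ℚ)))
    (hgood : ∀ v ∉ S, (p : 𝓞 ℚ) ∉ v.asIdeal ∧ W.HasGoodReductionAt v) (hB : ¬ p ∣ W.tamagawaProduct)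
    (Dh : PAdicHeightData W p) (hlow : CycLowerBoundAt W p Dh) : BSDp W p :=
  ClassX4M.bsdp_rankZero_of_surj_of_lower_of_prop414 h414 hT41 hGZK hmod hmodD hL20 hKato hX hr hsurj S
    hgood hB
    (Additive.ClassX4M.missingLowerBoundAt_rankZero_of_cycLowerBound_tamagawaSharp hT41 hX hGZK hr S hgood
      Dh hlow)

end Summit.BirchSwinnertonDyer.Rank1Residual.AdditivePotMult

end
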